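import Summits.ResolutionOfSingularities.ResolutionOfSingularities.Theorems.PurelyInseparableDim4ResConeLayerBirths
import HarnessLib
import HarnessLib.Audit.Tags

/-!
# Purely inseparable four-folds — BINOMIAL TRANSPORT OF A PURE-SHEAR STEP: the coefficient law of
# `shear a (t·e_{a′})` (the substitution `x_{a′} ↦ x_{a′} + t·x_a`) and of the point step at the point `t·e_{a′}` of the
# `x_a`-chart (K2(p) lane, SLICE C (C17): the workhorse asked for by res-dim4-idea-4 g3 for the E2 §D (D∞) and B∞
# lossy arguments, bus 2026-08-29T01:37:02Z; file-holder res-dim4-p-5 g3)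

[OURS · counted 0 · cell `res-dim4-pi` · K2(p) lane (desk WORDS #78 (d), #80 (d), #96 (b), #105 (d)) · seat p-5 g3.]
Nothing here proves K2(p), `NoIsolatedTrap p p` or resolution of singularities in dimension ≥ 4 / char. `p`.

ROWS.  For a multidegree `e` call `(e_a + e_{a′}; e|_{passive})` its ROW: the one-letter shear `x_{a′} ↦ x_{a′} + t x_a`
preserves rows and moves mass from `a′` to `a` binomially.  With `src e l := e` with `a ↦ e_a − l`, `a′ ↦ e_{a′} + l`:
* `shear_single_monomial` — FORWARD: `shear a (t e_{a′}) (c·x^m) = Σ_{l ≤ m_{a′}} C(m_{a′}, l) t^l c · x^{m − l e_{a′} + l e_a}`;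
* `coeff_shear_single` — BACKWARD (the coefficient law): `coeff_e (shear a (t e_{a′}) F) =
  Σ_{l ≤ e_a} C(e_{a′} + l, l) · t^l · coeff_{src e l} F` — «the (A, κ)-row of the sheared polynomial, as a
  polynomial in `x_{a′}`, is the row's binary form `R_{A,κ}(x_a, x_{a′} + t x_a)`; its `x_{a′}`-adic order is the
  multiplicity of the root `x_{a′} = t x_a`» (idea-4 E2 §D, coefficientwise; Lucas for `C(·,·) mod p` is left to
  the user);
* `coeff_shear_single_row_bottom` — the bottom of a row (`e_{a′} = 0`) reads the VALUE `R_{A,κ}(1, t)`: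
  `coeff_e = Σ_{l ≤ e_a} t^l coeff_{src e l} F`;
* `coeff_step_single_chartExponent` — THE PURE-SHEAR STEP: for the point step in the `x_a`-chart at the point
  `t·e_{a′}` (translation of `x_{a′}` only), `coeff_{chartExponent e} F′ = [not a p-th power] · coeff_e (shear … F)`
  (`…LayerBirths.coeff_step_F_chartExponent`), hence the binomial law for the child before/after cleaning.
[cite: Hauser2010, §I (definition of P⁺)] [cite: HauserPerlega2019PRIMS, §2 (transform at a translated point)]
[cite: CossartJannsenSaito2020, Lemma 13.2, Thm. 13.7]
bears_on: LADDER-RESOLUTION:D157-DOOR2 (res-dim4-pi · K2(p) = `RidgeBudget.NoAboveFloorTrap p p` · slice C, lossy residual).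
Supports stmt-ResolutionOfSingularities-16155 (helper).
-/

set_option linter.dupNamespace false -- mandated namespace of this single-conjunct summit

noncomputable section

namespace Summit.ResolutionOfSingularities.ResolutionOfSingularities.Theorems.PIDim4

namespace ResCone

open MvPolynomial Finset
open Literature.AlgebraicGeometry.Resolution
open Literature.AlgebraicGeometry.Resolution.CentreBlowup
open Literature.AlgebraicGeometry.Resolution.Hauser2010
open Literature.AlgebraicGeometry.Resolution.HauserPerlega2019

variable {K : Type} [Field K]

section Shear

/-- The image multidegree of the `l`-th binomial term of `shear a (t e_{a′}) (x^m)`. [folklore] -/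
theorem shear_target_apply {a a' : Fin 4} (haa : a ≠ a') (m : Fin 4 →₀ ℕ) (l : ℕ) (i : Fin 4) :
    ((m.update a' (m a' - l)).update a (m a + l)) i =
      if i = a then m a + l else if i = a' then m a' - l else m i := by
  by_cases hia : i = a
  · subst hia; rw [Finsupp.coe_update, Function.update_self, if_pos rfl]
  · rw [Finsupp.coe_update, Function.update_of_ne hia, if_neg hia, Finsupp.coe_update]
    by_cases hia' : i = a'
    · subst hia'; rw [Function.update_self, if_pos rfl]
    · rw [Function.update_of_ne hia', if_neg hia']

/-- `(x_{a′} + t x_a)^n` expanded in monomials. [folklore] -/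
theorem X_add_C_mul_X_pow (a a' : Fin 4) (t : K) (n : ℕ) :
    ((X a' : MvPolynomial (Fin 4) K) + C t * X a) ^ n =
      ∑ l ∈ Finset.range (n + 1), monomial (Finsupp.single a l + Finsupp.single a' (n - l)) ((n.choose l : K) * t ^ l) := by
  rw [add_comm, add_pow]
  refine Finset.sum_congr rfl fun l _ => ?_
  rw [mul_pow, ← map_pow, X_pow_eq_monomial, X_pow_eq_monomial, ← map_natCast (C : K →+* MvPolynomial (Fin 4) K),
    C_mul_monomial, monomial_mul, mul_comm (monomial _ _) (C _), C_mul_monomial]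
  congr 1
  ring

/-- **FORWARD LAW**: the one-letter shear `x_{a′} ↦ x_{a′} + t x_a` on a monomial:
`shear a (t e_{a′}) (c x^m) = Σ_{l ≤ m_{a′}} C(m_{a′}, l) t^l c · x^{m + l e_a − l e_{a′}}`. [folklore]
[cite: Hauser2010, §I (definition of P⁺)] -/
theorem shear_single_monomial {a a' : Fin 4} (haa : a ≠ a') (t c : K) (m : Fin 4 →₀ ℕ) :
    shear a (Pi.single a' t) (monomial m c) =
      ∑ l ∈ Finset.range (m a' + 1),
        monomial ((m.update a' (m a' - l)).update a (m a + l)) (c * ((m a').choose l : K) * t ^ l) := by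
  classical
  unfold shear
  rw [aeval_monomial, algebraMap_eq, Finsupp.prod_fintype _ _ (fun i => pow_zero _),
    ← Finset.mul_prod_erase Finset.univ _ (Finset.mem_univ a')]
  -- the factor at `a′`
  have hfa' : (if a' = a then (X a : MvPolynomial (Fin 4) K) else X a' + C ((Pi.single a' t : Fin 4 → K) a') * X a)
      = X a' + C t * X a := by
    rw [if_neg haa.symm, Pi.single_eq_same]
  -- the other factors are untouched
  have hrest : ∏ i ∈ Finset.univ.erase a',
      (if i = a then (X a : MvPolynomial (Fin 4) K) else X i + C ((Pi.single a' t : Fin 4 → K) i) * X a) ^ m i =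
      monomial (m.update a' 0) 1 := by
    rw [monomial_eq, C_1, one_mul, Finsupp.prod_fintype _ _ (fun i => pow_zero _),
      ← Finset.mul_prod_erase Finset.univ _ (Finset.mem_univ a'), Finsupp.coe_update, Function.update_self,
      pow_zero, one_mul]
    refine Finset.prod_congr rfl fun i hi => ?_
    have hia' : i ≠ a' := Finset.ne_of_mem_erase hi
    rw [Function.update_of_ne hia']
    by_cases hia : i = a
    · subst hia; rw [if_pos rfl]
    · rw [if_neg hia, show (Pi.single a' t : Fin 4 → K) i = 0 from Pi.single_eq_of_ne hia' _, C_0, zero_mul,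
        add_zero]
  rw [hfa', hrest, X_add_C_mul_X_pow, Finset.sum_mul, Finset.mul_sum]
  refine Finset.sum_congr rfl fun l _ => ?_
  rw [monomial_mul, C_mul_monomial, mul_one]
  have hexp : Finsupp.single a l + Finsupp.single a' (m a' - l) + m.update a' 0 =
      (m.update a' (m a' - l)).update a (m a + l) := by
    ext i
    rw [shear_target_apply haa, Finsupp.add_apply, Finsupp.add_apply, Finsupp.single_apply, Finsupp.single_apply,
      Finsupp.coe_update]
    by_cases hia : i = a
    · subst hia
      rw [if_pos rfl, if_pos rfl, if_neg haa.symm, Function.update_of_ne haa]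
      omega
    · by_cases hia' : i = a'
      · subst hia'
        rw [if_neg (Ne.symm hia), if_pos rfl, Function.update_self, if_neg hia, if_pos rfl]
        omega
      · rw [if_neg (Ne.symm hia), if_neg (Ne.symm hia'), Function.update_of_ne hia', if_neg hia, if_neg hia']
        omega
  rw [hexp, show c * (((m a').choose l : K) * t ^ l) = c * ((m a').choose l : K) * t ^ l by ring]

/-- **ROWS ARE PRESERVED, MASS MOVES FROM `a′` TO `a`**: every monomial of `shear a (t e_{a′}) F` comes from a
monomial of `F` in the same row with at least as much `a′`-mass. [folklore] [cite: Hauser2010, §I] -/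
theorem exists_of_mem_support_shear_single {a a' : Fin 4} (haa : a ≠ a') (t : K) (F : MvPolynomial (Fin 4) K)
    {e : Fin 4 →₀ ℕ} (he : e ∈ (shear a (Pi.single a' t) F).support) :
    ∃ m ∈ F.support, ∃ l, l ≤ m a' ∧ e = (m.update a' (m a' - l)).update a (m a + l) := by
  classical
  have hF : shear a (Pi.single a' t) F = ∑ m ∈ F.support, shear a (Pi.single a' t) (monomial m (coeff m F)) := by
    conv_lhs => rw [F.as_sum]
    unfold shear
    rw [map_sum]
  rw [hF] at he
  obtain ⟨m, hm, hem⟩ := Finset.mem_biUnion.mp (Finset.mem_of_subset (support_sum) he)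
  rw [shear_single_monomial haa] at hem
  obtain ⟨l, hl, hel⟩ := Finset.mem_biUnion.mp (Finset.mem_of_subset (support_sum) hem)
  refine ⟨m, hm, l, by have := Finset.mem_range.mp hl; omega, ?_⟩
  rw [MvPolynomial.mem_support_iff, coeff_monomial] at hel
  by_contra hne
  exact hel (if_neg (Ne.symm hne))

/-- **THE COEFFICIENT LAW (backward)**: `coeff_e (shear a (t e_{a′}) F) = Σ_{l ≤ e_a} C(e_{a′} + l, l) t^l coeff_{src e l} F`
with `src e l = e[a ↦ e_a − l, a′ ↦ e_{a′} + l]` — the `(e_a + e_{a′}; passive)`-row of the sheared polynomial is the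
row's binary form evaluated at `(x_a, x_{a′} + t x_a)`. [folklore] [cite: Hauser2010, §I (definition of P⁺)] -/
theorem coeff_shear_single {a a' : Fin 4} (haa : a ≠ a') (t : K) (F : MvPolynomial (Fin 4) K) (e : Fin 4 →₀ ℕ) :
    coeff e (shear a (Pi.single a' t) F) =
      ∑ l ∈ Finset.range (e a + 1),
        ((e a' + l).choose l : K) * t ^ l * coeff ((e.update a (e a - l)).update a' (e a' + l)) F := by
  classical
  -- linearity: reduce to monomials
  have hF : shear a (Pi.single a' t) F = ∑ m ∈ F.support, shear a (Pi.single a' t) (monomial m (coeff m F)) := by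
    conv_lhs => rw [F.as_sum]
    unfold shear
    rw [map_sum]
  rw [hF, coeff_sum]
  simp_rw [shear_single_monomial haa, coeff_sum, coeff_monomial]
  -- the (m, l) ↔ l bijection on a fixed target `e`
  have hkey : ∀ m : Fin 4 →₀ ℕ, ∀ l : ℕ, l ∈ Finset.range (m a' + 1) →
      ((m.update a' (m a' - l)).update a (m a + l) = e ↔
        (l ≤ e a ∧ m = (e.update a (e a - l)).update a' (e a' + l))) := by
    intro m l hl
    have hl' : l ≤ m a' := by have := Finset.mem_range.mp hl; omega
    have hsrc : ∀ i, ((e.update a (e a - l)).update a' (e a' + l)) i =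
        if i = a' then e a' + l else if i = a then e a - l else e i := shear_target_apply haa.symm e l
    have htgt : ∀ i, ((m.update a' (m a' - l)).update a (m a + l)) i =
        if i = a then m a + l else if i = a' then m a' - l else m i := shear_target_apply haa m l
    constructor
    · intro h
      have hi : ∀ i, (if i = a then m a + l else if i = a' then m a' - l else m i) = e i := fun i => by
        rw [← htgt i, h]
      have ha := hi a
      have ha' := hi a'
      rw [if_pos rfl] at ha
      rw [if_neg haa.symm, if_pos rfl] at ha'
      refine ⟨by omega, ?_⟩
      ext i
      rw [hsrc i]
      by_cases hia' : i = a'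
      · subst hia'; rw [if_pos rfl]; omega
      · rw [if_neg hia']
        by_cases hia : i = a
        · subst hia; rw [if_pos rfl]; omega
        · rw [if_neg hia]
          have h3 := hi i
          rw [if_neg hia, if_neg hia'] at h3
          exact h3
    · rintro ⟨hle, hm⟩
      have hmi : ∀ i, m i = if i = a' then e a' + l else if i = a then e a - l else e i := fun i => by
        rw [← hsrc i, ← hm]
      ext i
      rw [htgt i]
      by_cases hia : i = a
      · subst hia
        have := hmi i
        rw [if_neg haa, if_pos rfl] at this
        rw [if_pos rfl]; omega
      · rw [if_neg hia]
        by_cases hia' : i = a'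
        · subst hia'
          have := hmi i
          rw [if_pos rfl] at this
          rw [if_pos rfl]; omega
        · have := hmi i
          rw [if_neg hia', if_neg hia] at this
          rw [if_neg hia', this]
  -- rewrite each inner sum to a single indicator on `m`
  have hinner : ∀ m ∈ F.support,
      (∑ l ∈ Finset.range (m a' + 1),
        if (m.update a' (m a' - l)).update a (m a + l) = e then coeff m F * ((m a').choose l : K) * t ^ l else 0) =
      ∑ l ∈ Finset.range (e a + 1),
        if m = (e.update a (e a - l)).update a' (e a' + l) then
          ((e a' + l).choose l : K) * t ^ l * coeff ((e.update a (e a - l)).update a' (e a' + l)) F else 0 := by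
    intro m _
    -- both sides have at most one non-zero term, at the same `l`
    rw [Finset.sum_ite, Finset.sum_const_zero, add_zero, Finset.sum_ite, Finset.sum_const_zero, add_zero]
    have hfilter : (Finset.range (m a' + 1)).filter (fun l => (m.update a' (m a' - l)).update a (m a + l) = e) =
        (Finset.range (e a + 1)).filter (fun l => m = (e.update a (e a - l)).update a' (e a' + l)) := by
      ext l
      simp only [Finset.mem_filter, Finset.mem_range]
      constructor
      · rintro ⟨hl, h⟩
        have h2 := (hkey m l (Finset.mem_range.mpr hl)).mp h
        exact ⟨by omega, h2.2⟩
      · rintro ⟨hl, h⟩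
        have hma' : m a' = e a' + l := by
          rw [h, shear_target_apply haa.symm, if_pos rfl]
        have hlr : l ∈ Finset.range (m a' + 1) := Finset.mem_range.mpr (by omega)
        exact ⟨by omega, (hkey m l hlr).mpr ⟨by omega, h⟩⟩
    rw [hfilter]
    refine Finset.sum_congr rfl fun l hl => ?_
    obtain ⟨-, hm⟩ := Finset.mem_filter.mp hl
    have hma' : m a' = e a' + l := by rw [hm, shear_target_apply haa.symm, if_pos rfl]
    rw [← hm, hma']
    ring
  rw [Finset.sum_congr rfl hinner, Finset.sum_comm]
  refine Finset.sum_congr rfl fun l _ => ?_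
  rw [Finset.sum_ite_eq' F.support]
  split_ifs with hmem
  · rfl
  · rw [MvPolynomial.notMem_support_iff.mp hmem, mul_zero]

/-- **The bottom of a row reads the value `R(1, t)`**: for `e_{a′} = 0`,
`coeff_e (shear a (t e_{a′}) F) = Σ_{l ≤ e_a} t^l · coeff_{e[a ↦ e_a − l, a′ ↦ l]} F`. [folklore]
[cite: Hauser2010, §I (definition of P⁺)] -/
theorem coeff_shear_single_row_bottom {a a' : Fin 4} (haa : a ≠ a') (t : K) (F : MvPolynomial (Fin 4) K)
    {e : Fin 4 →₀ ℕ} (hea' : e a' = 0) :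
    coeff e (shear a (Pi.single a' t) F) =
      ∑ l ∈ Finset.range (e a + 1), t ^ l * coeff ((e.update a (e a - l)).update a' l) F := by
  rw [coeff_shear_single haa]
  refine Finset.sum_congr rfl fun l _ => ?_
  rw [hea', zero_add, Nat.choose_self, Nat.cast_one, one_mul]

end Shear

section Step

variable [DecidableEq K]

/-- **THE PURE-SHEAR STEP** (point step in the `x_a`-chart at the point `t·e_{a′}`): the coefficient of the chart
image `x^{chartExponent e}` in the child is `coeff_e` of the SHEARED polynomial — given by the binomial row law
`coeff_shear_single` — unless the image is a `q`-th power (deleted by the cleaning). [folklore]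
[cite: HauserPerlega2019PRIMS, §2 (transform at a translated point)] -/
theorem coeff_step_single_chartExponent (q : ℕ) {a a' : Fin 4} (haa : a ≠ a') (t : K) (s : State K)
    (hq : (q : ℕ∞) ≤ ordAlong Finset.univ s.F) {e : Fin 4 →₀ ℕ} (he : q ≤ e.degree) :
    coeff (chartExponent q Finset.univ a e) (CentreBlowup.step q Finset.univ a (Pi.single a' t) s).F =
      if IsPthPowerExponent q (chartExponent q Finset.univ a e) then 0 else
        ∑ l ∈ Finset.range (e a + 1),
          ((e a' + l).choose l : K) * t ^ l * coeff ((e.update a (e a - l)).update a' (e a' + l)) s.F := by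
  rw [coeff_step_F_chartExponent q a (show (Pi.single a' t : Fin 4 → K) a = 0 by rw [Pi.single_eq_of_ne haa])
    s hq he, coeff_shear_single haa]

/-- **Backward reading of the pure-shear step**: every monomial of the child is the chart image of a monomial of
the sheared polynomial, hence of a source monomial of `F` in the same row with at least as much `a′`-mass.
[folklore] [cite: HauserPerlega2019PRIMS, §2 (transform at a translated point)] -/
theorem exists_of_mem_support_step_single (q : ℕ) {a a' : Fin 4} (haa : a ≠ a') (t : K) (s : State K)
    (hq : (q : ℕ∞) ≤ ordAlong Finset.univ s.F) {E : Fin 4 →₀ ℕ}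
    (hE : E ∈ (CentreBlowup.step q Finset.univ a (Pi.single a' t) s).F.support) :
    ∃ m ∈ s.F.support, ∃ l, l ≤ m a' ∧ chartExponent q Finset.univ a ((m.update a' (m a' - l)).update a (m a + l)) = E := by
  obtain ⟨e, he, heE, -⟩ := exists_of_mem_support_step q a
    (show (Pi.single a' t : Fin 4 → K) a = 0 by rw [Pi.single_eq_of_ne haa]) s hq hE
  obtain ⟨m, hm, l, hl, rfl⟩ := exists_of_mem_support_shear_single haa t s.F he
  exact ⟨m, hm, l, hl, heE⟩

end Step

end ResCone

end Summit.ResolutionOfSingularities.ResolutionOfSingularities.Theorems.PIDim4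

end
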